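import Literature.MathematicalPhysics.QuantumFieldTheory.Balaban1983to89.B2Eq328DeltaK
import Literature.MathematicalPhysics.QuantumFieldTheory.Balaban1983to89.B2Eq324NestedRegions
import Literature.MathematicalPhysics.QuantumFieldTheory.Balaban1983to89.B2Ineq329ZeroAveraging

/-!
# `Balaban1983to89.B2Prop31ZeroFieldConcrete` — [Balaban1982Higgs2] Proposition 3.1 p. 589, ITS ZERO-FIELD CLAUSE
*"If Ã^ε = 0, then the inequality holds without the last sum on the right side and without any restrictions on the
configuration Φ"* PROVED, HYPOTHESIS-FREE, ON THE CONCRETE (3.23)/(3.24)/(3.25) CARRIER of the (Higgs)₂,₃ model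
(`B2Eq337ScalarIntegration` / `B2Eq325ConcreteSchur` / `B2Ineq327ConcreteNeumann` / `B2Eq328ConcretePieces`): the per-scale
inequality (3.29) at `Ã^η = 0` for the forms `⟨φ_k, Δ^{(k),Lᵏε}(Bᵏ(Λ_k), 0)φ_k⟩ = termForm R C a 0 m² j` with ONE explicit constant
`γ₀ = min(a(1 − L⁻²)/(8d + 2m²), 1/4)` and NO error term (`ineq329_zero_concrete`), and then (3.26)₀ for `⟨Φ, Δ(0)Φ⟩ = form325 R C a 0 m² Φ`
by the printed reduction already kernel-checked in `B2Eq328ConcretePieces.prop31_concrete` with its hypothesis `h329` DISCHARGED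
(`prop31_zeroField_concrete`; for the printed tower of large-field regions `prop31_zeroField_tower`)

statement-level skeleton of published theorems with citation tags; proofs where landed; nothing here is a claim about the Yang–Mills mass gap

CITATION HEADER.  T. Bałaban, *(Higgs)₂,₃ quantum fields in a finite volume. II. An upper bound*, Commun. Math. Phys. **86**
(1982) 555–594 [Balaban1982Higgs2], Prop. 3.1 (3.26) p. 589 and (3.27)–(3.29) pp. 589–590 (PDF held
`paper:balaban1982-cmp86-higgs23-ii`; pp. 589–590 [PDF 35–36] READ AS IMAGES on the ×2 renders
`run/shared/lean/pub/pub-balaban/b2b-balaban-ref1/pages/1982-cmp86-higgs23-II/1982-cmp86-higgs23-II-p035-x2.png`, `-p036-x2.png`);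
[Balaban1983RegularityDecay] (1.22) p. 574 (*"This theorem implies (3.29) of [2]"*); [Balaban1982Higgs1] (2.15) p. 609
(`a_k ↘ a_∞ = a(1 − L⁻²)`), (2.17)–(2.19) p. 610.  Unit `lit-balaban-p15` gen 4, target 3, file 2 (Phase-2 proof seat p15; HOME
`run/shared/lean/pub/lit-balaban/`).  SKELETON rows **B2.Prop3.1** (decl of record `B2.Prop31Printed`; owner r02) and **B2.Eq3.29**
((3.27)–(3.29); of record `B2.Ineq329Printed`).  RELATED, BY NAME, NOT RESTATED: r14's `B2Prop31ZeroField` (the same clause on the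
ℤ^{d+1} carriers, (3.27)/(3.28) carried as instance data, via `B4Prop31Zero.KeffR_form_ge`) and `B2Prop31ZeroFieldModel`; here the
clause is proved where (3.25), (3.27), (3.28) THEMSELVES are proved (p252464, p254057, p254943), so that no input remains.

WHAT IS PRINTED.  p. 589 [PDF 35]: *"**Proposition 3.1.** There exists a constant γ₀ > 0 dependent on the space dimension d and
the constant a only, and independent of ε and a choice of the sets Λ₅⁽⁰⁾, …, Λ₅⁽ᴷ⁻¹⁾, such that … ⟨Φ, Δ(Ã^ε)Φ⟩ ≥ γ₀ Σ_{k=0}^{K}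
Σ_{⟨x,x′⟩⊂Λ₅⁽ᵏ⁻¹⁾′∩Λ₅⁽ᵏ⁾ᶜ} (Lᵏε)^{d−2}|U(Ã^ε(⟨x,x′⟩))φ_k(x′) − φ_k(x)|² + γ₀ Σ_{k=0}^{K} Σ_{x∈Λ₅⁽ᵏ⁻¹⁾′∩Λ₅⁽ᵏ⁾ᶜ} (Lᵏε)^d m²|φ_k(x)|²
− Σ_{k=1}^{K} O((Lᵏε)^{κ₀})|(Λ₅⁽ᵏ⁻¹⁾′∩Λ₅⁽ᵏ⁾ᶜ)₁|, (3.26) … We assume m² ≤ O(1) also. If Ã^ε = 0, then the inequality holds without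
the last sum on the right side and without any restrictions on the configuration Φ."*; p. 590: *"Now inequality (3.26) of the
proposition follows from ⟨φ′_k, Δ⁽ᵏ⁾(Bᵏ(Λ_k), Ã^η)φ′_k⟩ ≥ γ₀(Σ_{⟨x,x′⟩⊂Λ_k}|U(Ã^η(⟨x,x′⟩))φ′_k(x′) − φ′_k(x)|² + Σ_{x∈Λ_k}
m²(Lᵏε)²|φ′_k(x)|²) − O((Lᵏε)^{κ₀})|Λ_k|, (3.29) with a constant γ₀ independent of k, Λ_k"*.

DICTIONARY.  `bondK R j ψ` = the k-th bond sum of (3.26) at `U ≡ 1` (`k = j + 1`): `Σ_{⟨y,y′⟩⊂Λ_k}(Lᵏε)^{d−2}|ψ(y′) − ψ(y)|²`, written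
`Σ_{c⊂Λ_k}(Lᵏε)^d|(∂^{Lᵏε}ψ̃)(c)|²` with `ψ̃ = extL ψ` (`bondK_eq_sum_printed`; = `⟨ψ̃, (−Δ^{Lᵏε,N}_{0,Λ_k})ψ̃⟩`, `bondK_eq_siteInner`);
`massK R m² j ψ` = `Σ_{y∈Λ_k}(Lᵏε)^d m²|ψ(y)|²`; the k-th form `⟨φ_k, Δ^{(k),Lᵏε}(Bᵏ(Λ_k), 0)φ_k⟩` = `B2Eq328ConcretePieces.termForm R C a 0 m² j`
(the fibre minimum of the (I.2.19) exponent `pieceExp`; = `⟨ψ̃, Δ^{(k)}(Ω,0)ψ̃⟩` of (I.2.21) by `B2Eq328DeltaK.termForm_eq_deltaKA`).  NO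
rescaling to the unit lattice is performed: (3.29) is proved directly in the `Lᵏε`-lattice variables of (3.26) (the two forms
differ by the identity rescaling `B2.rescale_bond`/`rescale_mass`).

THE MECHANISM (elementary; the one of `B4Prop31Zero.KeffR_form_ge`, re-run on the torus carrier; simpler here because `termForm` is an
infimum over the fibre variable `v`, so a bound of `pieceExp ψ v` for EVERY `v` suffices and no Green's function is needed).  With
`s = Lᵏε ≤ 1`, `Ω = Bᵏ(Λ_k)`, `ṽ = extP v`, `w = Q_k(0)ṽ`, `u = ψ̃ − w`:  `pieceExp ψ v = a_k s⁻²·T₁ + T₂ + m²T₃`, `T₁ = Σ_{y∈Λ_k}s^d|u(y)|²`,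
`T₂ = Σ_{b⊂Ω}ε^d|∂ṽ(b)|²`, `T₃ = Σ_{x∈Ω}ε^d|ṽ(x)|²` (`pieceExp_zero_eq`); `bondK ≤ 2E(u) + 2E(w) ≤ 8d s⁻²T₁ + 4T₂` (site-to-bond
`B2Ineq329ZeroAveraging.bondSum_le_siteSum`, AVERAGING INEQUALITY `…averaging_ineq`); `massK ≤ 2m²T₁ + 2m²Σ_{y}s^d|w(y)|² ≤ 2m²s²·s⁻²T₁ + 2m²T₃`
(JENSEN `…jensen_sum`); `a_k > a(1 − L⁻²)` (`B1.ainf_lt_aSeq`); hence `γ₀(bondK + massK) ≤ pieceExp ψ v`.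

WHAT THIS MODULE PROVES (kernel-checked, 0 `sorry`, standard axioms; every `m² ≥ 0`, `a > 0`, `L > 1`, `K ≤` the number of scales
of the lattice family, `Lᵏε ≤ 1`).  §1 `bondK`, `massK` (+ printed forms, non-negativity), `gamma0` (+ `gamma0_pos`).  §2
`pieceExp_zero_eq`, `bondK_le`, `massK_le`, **`sum329_le_pieceExp`**, **`ineq329_zero_concrete`** ((3.29)₀: `γ₀(bondK + massK) ≤ termForm R C a 0 m² j ψ`
for EVERY `ψ`).  §3 **`prop31_zeroField_concrete`**: for every nested region data `R` and EVERY `Φ`,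
`γ₀(bond₀ + Σ_k bondK) + γ₀(mass₀ + Σ_k massK) ≤ ⟨Φ, Δ(0)Φ⟩ = form325 R C a 0 m² Φ`; `prop31_zeroField_tower` (the printed regions).
HONEST SCOPE.  (i) `Ã = 0` ONLY; nothing of the restricted clause (`Ã ≠ 0`, error `O((Lᵏε)^{κ₀})|Λ_k|`; its input is B4's Prop. 3.1′,
cell GAPS G-pv07-1).  (ii) `γ₀` depends on `d`, `a`, `L` (through `a_∞`) and the bound `m²` (the print's *"We assume m² ≤ O(1) also"*);
no constant is optimised.  (iii) `Lᵏε ≤ 1` for `k ≤ K` is the stopping rule `Lᴷε ≤ ε₀ ≤ 1` (p. 582), carried as the hypothesis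
`P.mesh K ≤ 1`.
-/

noncomputable section

open MeasureTheory Finset Real
open scoped BigOperators ENNReal InnerProductSpace

namespace Literature.MathematicalPhysics.QuantumFieldTheory.Balaban1983to89.B2Prop31ZeroFieldConcrete

open Literature.MathematicalPhysics.QuantumFieldTheory.Balaban1983to89.HiggsLattice
open Literature.MathematicalPhysics.QuantumFieldTheory.Balaban1983to89.HiggsAveraging
open Literature.MathematicalPhysics.QuantumFieldTheory.Balaban1983to89.HiggsCovariance
open Literature.MathematicalPhysics.QuantumFieldTheory.Balaban1983to89.HiggsCovariancePos
open Literature.MathematicalPhysics.QuantumFieldTheory.Balaban1983to89.HiggsFluctMeasure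
open Literature.MathematicalPhysics.QuantumFieldTheory.Balaban1983to89.B1Eq230FluctCov
open Literature.MathematicalPhysics.QuantumFieldTheory.Balaban1983to89.B2Ineq338Diamagnetic
open Literature.MathematicalPhysics.QuantumFieldTheory.Balaban1983to89.B2Eq337ScalarIntegration
open Literature.MathematicalPhysics.QuantumFieldTheory.Balaban1983to89.B2Eq325ConcreteSchur
open Literature.MathematicalPhysics.QuantumFieldTheory.Balaban1983to89.B2Ineq327ConcreteNeumann
open Literature.MathematicalPhysics.QuantumFieldTheory.Balaban1983to89.B2Eq328ConcretePieces
open Literature.MathematicalPhysics.QuantumFieldTheory.Balaban1983to89.B2Eq328DeltaK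
open Literature.MathematicalPhysics.QuantumFieldTheory.Balaban1983to89.B2Eq324NestedRegions
open Literature.MathematicalPhysics.QuantumFieldTheory.Balaban1983to89.B2Ineq329ZeroAveraging

variable {P : HiggsLattice.Params} {N K : ℕ}

/-! ## §1 The zero-field bond and mass sums of (3.26)/(3.29) for `k ≥ 1`, and the constant `γ₀` -/

section Functionals

variable (R : Regions P K) (msq : ℝ)

/-- **The k-th bond sum of (3.26) at `Ã = 0`** (`k = j + 1`, `U ≡ 1`): `Σ_{⟨y,y′⟩⊂Λ_k}(Lᵏε)^{d−2}|ψ(y′) − ψ(y)|²`, written with the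
difference derivative of the zero extension `ψ̃` as `Σ_{c⊂Λ_k}(Lᵏε)^d|(∂^{Lᵏε}ψ̃)(c)|²`. [cite: Balaban1982Higgs2, Prop. 3.1 (3.26) p.589] -/
def bondK (j : Fin K) (ψ : LSite R j → V N) : ℝ :=
  ∑ c : HiggsLattice.PBond P (j.val + 1), if Inside (R.block j) c then
    P.mesh (j.val + 1) ^ P.d * ‖sderiv (extL R j ψ) c‖ ^ 2 else 0

/-- **The k-th mass sum of (3.26)** (`k = j + 1`): `Σ_{y∈Λ_k}(Lᵏε)^d m²|ψ(y)|²`. [cite: Balaban1982Higgs2, Prop. 3.1 (3.26) p.589] -/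
def massK (j : Fin K) (ψ : LSite R j → V N) : ℝ :=
  ∑ y : LSite R j, P.mesh (j.val + 1) ^ P.d * msq * ‖ψ y‖ ^ 2

/-- `ψ̃` on `Λ_k`. [cite: Balaban1982Higgs2, (3.24) p.588] -/
theorem extL_apply_of (j : Fin K) (ψ : LSite R j → V N) {y : HiggsLattice.Site P (j.val + 1)} (h : y ∈ R.block j) :
    extL R j ψ y = ψ ⟨y, h⟩ := by
  simp [extL, h]

/-- `ψ̃` off `Λ_k`. [cite: Balaban1982Higgs2, (3.24) p.588] -/
theorem extL_apply_of_not (j : Fin K) (ψ : LSite R j → V N) {y : HiggsLattice.Site P (j.val + 1)} (h : y ∉ R.block j) :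
    extL R j ψ y = 0 := by
  simp [extL, h]

/-- The printed form of the summands: `(Lᵏε)^d·(Lᵏε)⁻²·|ψ̃(y′) − ψ̃(y)|² = (Lᵏε)^{d−2}|ψ(y′) − ψ(y)|²` for `⟨y,y′⟩ ⊂ Λ_k`.
[cite: Balaban1982Higgs2, Prop. 3.1 (3.26) p.589] -/
theorem bondK_eq_sum_printed (j : Fin K) (ψ : LSite R j → V N) :
    bondK R j ψ = ∑ c : HiggsLattice.PBond P (j.val + 1), if Inside (R.block j) c then
      P.mesh (j.val + 1) ^ P.d * (P.mesh (j.val + 1))⁻¹ ^ 2 * ‖extL R j ψ c.tgt - extL R j ψ c.src‖ ^ 2 else 0 := by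
  unfold bondK
  refine Finset.sum_congr rfl fun c _ => ?_
  split_ifs
  · rw [bondSummand_eq]
  · rfl

/-- `bondK = ⟨ψ̃, (−Δ^{Lᵏε,N}_{0,Λ_k})ψ̃⟩_{T⁽ᵏ⁾}` (the tree's Neumann form `HiggsCovariance.covLaplacianN` at level k, zero vector field).
[cite: Balaban1982Higgs1, (2.17) p.610] -/
theorem bondK_eq_siteInner (C : ChargeData N) (j : Fin K) (ψ : LSite R j → V N) :
    bondK R j ψ = siteInner (extL R j ψ)
      (covLaplacianN C (R.block j) (0 : HiggsLattice.VecField P (j.val + 1)) (extL R j ψ)) := by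
  rw [bondK, siteInner_covLaplacianN]
  refine Finset.sum_congr rfl fun c _ => ?_
  split_ifs
  · rw [HiggsLattice.covDeriv_zero, real_inner_self_eq_norm_sq]
  · rfl

/-- `massK = m²⟨ψ̃, ψ̃⟩_{T⁽ᵏ⁾}`. [cite: Balaban1982Higgs2, Prop. 3.1 (3.26) p.589] -/
theorem massK_eq_siteInner (j : Fin K) (ψ : LSite R j → V N) :
    massK R msq j ψ = msq * siteInner (extL R j ψ) (extL R j ψ) := by
  rw [massK, siteInner_self_split_lvl R j]
  have h0 : ∑ y ∈ (R.block j)ᶜ, P.mesh (j.val + 1) ^ P.d * ‖extL R j ψ y‖ ^ 2 = 0 :=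
    Finset.sum_eq_zero fun y hy => by
      rw [extL_apply_of_not R j ψ (Finset.mem_compl.mp hy), norm_zero]
      simp
  rw [h0, add_zero, Finset.mul_sum]
  refine Finset.sum_congr rfl fun y _ => ?_
  rw [extL_apply_of R j ψ y.prop]
  ring

/-- `bondK ≥ 0`. [cite: Balaban1982Higgs2, Prop. 3.1 (3.26) p.589] -/
theorem bondK_nonneg (j : Fin K) (ψ : LSite R j → V N) : 0 ≤ bondK R j ψ :=
  Finset.sum_nonneg fun c _ => by
    split_ifs
    · exact mul_nonneg (pow_nonneg (P.mesh_pos _).le _) (sq_nonneg _)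
    · exact le_rfl

variable {msq}

/-- `massK ≥ 0` (`m² ≥ 0`). [cite: Balaban1982Higgs2, Prop. 3.1 (3.26) p.589] -/
theorem massK_nonneg (hmsq : 0 ≤ msq) (j : Fin K) (ψ : LSite R j → V N) : 0 ≤ massK R msq j ψ :=
  Finset.sum_nonneg fun _ _ => mul_nonneg (mul_nonneg (pow_nonneg (P.mesh_pos _).le _) hmsq) (sq_nonneg _)

/-- **The constant `γ₀ = min(a(1 − L⁻²)/(8d + 2m²), 1/4)`** — dependent on `d`, `a` (through `a_∞ = a(1 − L⁻²)` of (I.2.15)) and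
the bound `m²` only; independent of `ε`, `k`, the regions and the fields. [cite: Balaban1982Higgs2, Prop. 3.1 p.589] -/
def gamma0 (P : HiggsLattice.Params) (a msq : ℝ) : ℝ :=
  min (a * (1 - ((P.L : ℝ) ^ 2)⁻¹) / (8 * P.d + 2 * msq)) (1 / 4)

/-- `γ₀ > 0` (`a > 0`, `L > 1`, `m² ≥ 0`). [cite: Balaban1982Higgs2, Prop. 3.1 p.589] -/
theorem gamma0_pos {a : ℝ} (ha : 0 < a) (hL : 1 < P.L) (hmsq : 0 ≤ msq) : 0 < gamma0 P a msq := by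
  have hL' : (1 : ℝ) < P.L := by exact_mod_cast hL
  have h1 : 0 < 1 - ((P.L : ℝ) ^ 2)⁻¹ := by
    have : (1 : ℝ) < (P.L : ℝ) ^ 2 := by nlinarith
    have : ((P.L : ℝ) ^ 2)⁻¹ < 1 := inv_lt_one_of_one_lt₀ this
    linarith
  have hd : (1 : ℝ) ≤ P.d := by exact_mod_cast P.hd
  unfold gamma0
  refine lt_min (div_pos (mul_pos ha h1) (by linarith)) (by norm_num)

end Functionals

/-! ## §2 (3.29) at `Ã^η = 0` on the concrete carrier -/

section Ineq329

variable (R : Regions P K) (C : ChargeData N) {a msq : ℝ}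

/-- `|u + v|² ≤ 2|u|² + 2|v|²`. [folklore] [cite: Balaban1983RegularityDecay, (1.22) p.574] -/
theorem norm_add_sq_le' {E : Type*} [SeminormedAddCommGroup E] (u v : E) : ‖u + v‖ ^ 2 ≤ 2 * ‖u‖ ^ 2 + 2 * ‖v‖ ^ 2 := by
  have h := norm_add_le u v
  have hsq : ‖u + v‖ * ‖u + v‖ ≤ (‖u‖ + ‖v‖) * (‖u‖ + ‖v‖) := mul_le_mul h h (norm_nonneg _) (by positivity)
  nlinarith [hsq, sq_nonneg (‖u‖ - ‖v‖)]

/-- The difference derivative (I.1.4) is additive. [cite: Balaban1982Higgs1, (1.4) p.604] -/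
theorem sderiv_add' {k : ℕ} (f g : ScalarField P k N) (b : HiggsLattice.PBond P k) :
    sderiv (f + g) b = sderiv f b + sderiv g b := by
  unfold sderiv
  rw [Pi.add_apply, Pi.add_apply, ← smul_add]
  congr 1
  abel

/-- `x ∈ Bᵏ(Λ_k)` iff `x_k ∈ Λ_k` (the shape of `Ω` used by `B2Ineq329ZeroAveraging`). [cite: Balaban1982Higgs2, (3.28) p.589] -/
theorem mem_pieceF_iff (j : Fin K) (x : HiggsLattice.Site P 0) : x ∈ pieceF R j ↔ blockIter (j.val + 1) x ∈ R.block j :=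
  mem_pieceF R j x

/-- **The (I.2.19) exponent at `Ã = 0`, decomposed**: `pieceExp ψ v = a_k(Lᵏε)⁻²·T₁ + T₂ + m²·T₃` with
`T₁ = Σ_{y∈Λ_k}(Lᵏε)^d|ψ(y) − (Q_k(0)ṽ)(y)|²`, `T₂ = Σ_{b⊂Ω}ε^d|(∂^ε ṽ)(b)|²`, `T₃ = Σ_{x∈Ω}ε^d|v(x)|²` (`ṽ = extP v`).
[cite: Balaban1982Higgs1, (2.19) p.610] -/
theorem pieceExp_zero_eq (a msq : ℝ) (j : Fin K) (ψ : LSite R j → V N) (v : PSite R j → V N) :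
    pieceExp R C a (0 : HiggsLattice.VecField P 0) msq j ψ v
      = B1.aSeq a P.L (j.val + 1) * (P.mesh (j.val + 1))⁻¹ ^ 2 *
          (∑ y : LSite R j, P.mesh (j.val + 1) ^ P.d *
            ‖ψ y - avgQk C (0 : HiggsLattice.VecField P 0) (j.val + 1) (extP R j v) y.val‖ ^ 2)
        + (∑ b : HiggsLattice.PBond P 0, if Inside (pieceF R j) b then
            P.mesh 0 ^ P.d * ‖sderiv (extP R j v) b‖ ^ 2 else 0)
        + msq * ∑ x : PSite R j, P.mesh 0 ^ P.d * ‖v x‖ ^ 2 := by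
  unfold pieceExp
  rw [add_assoc]
  congr 1
  · rw [Finset.mul_sum]
    refine Finset.sum_congr rfl fun y _ => ?_
    rw [precAt_eq, coeff221_eq]
    ring
  · rw [← siteBilin_apply, delta0_apply, map_add, map_smul, siteBilin_apply, siteBilin_apply, smul_eq_mul,
      siteInner_covLaplacianN, siteInner_extP_self]
    congr 1
    refine Finset.sum_congr rfl fun b _ => ?_
    split_ifs
    · rw [HiggsLattice.covDeriv_zero, real_inner_self_eq_norm_sq]
    · rfl

/-- **The bond sum bound**: `bondK ≤ 8d(Lᵏε)⁻²·T₁ + 4·T₂` (`ψ̃ = u + w`, `w = Q_k(0)ṽ`; site-to-bond for `u`, the averaging inequality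
for `w`). [cite: Balaban1983RegularityDecay, (1.22) p.574] [cite: Balaban1982Higgs2, (3.29) p.590] -/
theorem bondK_le (hK : K ≤ P.K) (j : Fin K) (ψ : LSite R j → V N) (v : PSite R j → V N) :
    bondK R j ψ ≤ 8 * P.d * (P.mesh (j.val + 1))⁻¹ ^ 2 *
          (∑ y : LSite R j, P.mesh (j.val + 1) ^ P.d *
            ‖ψ y - avgQk C (0 : HiggsLattice.VecField P 0) (j.val + 1) (extP R j v) y.val‖ ^ 2)
        + 4 * (∑ b : HiggsLattice.PBond P 0, if Inside (pieceF R j) b then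
            P.mesh 0 ^ P.d * ‖sderiv (extP R j v) b‖ ^ 2 else 0) := by
  classical
  have hk : j.val + 1 ≤ P.K := le_trans (Nat.succ_le_of_lt j.isLt) hK
  set w := avgQk C (0 : HiggsLattice.VecField P 0) (j.val + 1) (extP R j v) with hw
  -- `u = ψ̃ − w`
  have hsplit : extL R j ψ = (extL R j ψ - w) + w := (sub_add_cancel _ _).symm
  -- termwise `|∂ψ̃|² ≤ 2|∂u|² + 2|∂w|²`
  have h1 : bondK R j ψ ≤ 2 * (∑ c : HiggsLattice.PBond P (j.val + 1), if Inside (R.block j) c then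
        P.mesh (j.val + 1) ^ P.d * ‖sderiv (extL R j ψ - w) c‖ ^ 2 else 0)
      + 2 * (∑ c : HiggsLattice.PBond P (j.val + 1), if Inside (R.block j) c then
        P.mesh (j.val + 1) ^ P.d * ‖sderiv w c‖ ^ 2 else 0) := by
    rw [bondK, Finset.mul_sum, Finset.mul_sum, ← Finset.sum_add_distrib]
    refine Finset.sum_le_sum fun c _ => ?_
    split_ifs
    · have hd : sderiv (extL R j ψ) c = sderiv (extL R j ψ - w) c + sderiv w c := by
        conv_lhs => rw [hsplit]
        exact sderiv_add' _ _ c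
      rw [hd]
      have := norm_add_sq_le' (sderiv (extL R j ψ - w) c) (sderiv w c)
      have hm : 0 ≤ P.mesh (j.val + 1) ^ P.d := pow_nonneg (P.mesh_pos _).le _
      nlinarith
    · simp
  -- `u`: site-to-bond, and `Σ_{y∈Λ}(Lᵏε)^d|u(y)|² = T₁`
  have h2 := bondSum_le_siteSum (R.block j) (extL R j ψ - w)
  have hT1 : ∑ y ∈ R.block j, P.mesh (j.val + 1) ^ P.d * ‖(extL R j ψ - w) y‖ ^ 2
      = ∑ y : LSite R j, P.mesh (j.val + 1) ^ P.d * ‖ψ y - w y.val‖ ^ 2 := by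
    rw [← Finset.sum_coe_sort (R.block j)]
    refine Finset.sum_congr rfl fun y _ => ?_
    rw [Pi.sub_apply, extL_apply_of R j ψ y.prop]
  rw [hT1] at h2
  -- `w`: the averaging inequality
  have h3 := averaging_ineq hk C (R.block j) (pieceF R j) (mem_pieceF_iff R j) (extP R j v)
  have hd0 : (0 : ℝ) ≤ P.d := Nat.cast_nonneg _
  nlinarith [h1, h2, h3]

/-- **The mass sum bound**: `massK ≤ 2m²·T₁ + 2m²·T₃` (Jensen for the block means). [cite: Balaban1983RegularityDecay, (1.22) p.574]
[cite: Balaban1982Higgs2, (3.29) p.590] -/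
theorem massK_le (hmsq : 0 ≤ msq) (hK : K ≤ P.K) (j : Fin K) (ψ : LSite R j → V N) (v : PSite R j → V N) :
    massK R msq j ψ ≤ 2 * msq *
          (∑ y : LSite R j, P.mesh (j.val + 1) ^ P.d *
            ‖ψ y - avgQk C (0 : HiggsLattice.VecField P 0) (j.val + 1) (extP R j v) y.val‖ ^ 2)
        + 2 * msq * ∑ x : PSite R j, P.mesh 0 ^ P.d * ‖v x‖ ^ 2 := by
  classical
  have hk : j.val + 1 ≤ P.K := le_trans (Nat.succ_le_of_lt j.isLt) hK
  set w := avgQk C (0 : HiggsLattice.VecField P 0) (j.val + 1) (extP R j v) with hw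
  -- termwise `|ψ|² ≤ 2|ψ − w|² + 2|w|²`
  have h1 : massK R msq j ψ ≤ 2 * msq * (∑ y : LSite R j, P.mesh (j.val + 1) ^ P.d * ‖ψ y - w y.val‖ ^ 2)
      + 2 * msq * (∑ y : LSite R j, P.mesh (j.val + 1) ^ P.d * ‖w y.val‖ ^ 2) := by
    rw [massK, Finset.mul_sum, Finset.mul_sum, ← Finset.sum_add_distrib]
    refine Finset.sum_le_sum fun y _ => ?_
    have := norm_add_sq_le' (ψ y - w y.val) (w y.val)
    rw [sub_add_cancel] at this
    have hm : 0 ≤ P.mesh (j.val + 1) ^ P.d := pow_nonneg (P.mesh_pos _).le _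
    have hmm : 0 ≤ P.mesh (j.val + 1) ^ P.d * msq := mul_nonneg hm hmsq
    nlinarith
  -- Jensen: `Σ_{y∈Λ}(Lᵏε)^d|w(y)|² ≤ Σ_{x∈Ω}ε^d|ṽ(x)|² = T₃`
  have h2 := jensen_sum C hk (R.block j) (pieceF R j) (mem_pieceF_iff R j) (extP R j v)
  have hL : ∑ y ∈ R.block j, P.mesh (j.val + 1) ^ P.d * ‖w y‖ ^ 2
      = ∑ y : LSite R j, P.mesh (j.val + 1) ^ P.d * ‖w y.val‖ ^ 2 := by
    rw [← Finset.sum_coe_sort (R.block j)]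
  have hRt : ∑ x ∈ pieceF R j, P.mesh 0 ^ P.d * ‖extP R j v x‖ ^ 2 = ∑ x : PSite R j, P.mesh 0 ^ P.d * ‖v x‖ ^ 2 := by
    rw [Finset.sum_subtype (pieceF R j) (mem_pieceF R j)]
    refine Finset.sum_congr rfl fun x _ => ?_
    rw [extP_apply_of R j v x.prop]
  rw [hL, hRt] at h2
  nlinarith [h1, h2]

/-- **(3.29) at `Ã^η = 0`, pointwise in the fibre variable**: `γ₀(bondK + massK) ≤ pieceExp ψ v` for EVERY `v` (`Lᵏε ≤ 1`, `k ≤ K`).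
[cite: Balaban1982Higgs2, (3.29) p.590] [cite: Balaban1983RegularityDecay, (1.22) p.574] -/
theorem sum329_le_pieceExp (ha : 0 < a) (hL : 1 < P.L) (hmsq : 0 ≤ msq) (hK : K ≤ P.K) (j : Fin K)
    (hs : P.mesh (j.val + 1) ≤ 1) (ψ : LSite R j → V N) (v : PSite R j → V N) :
    gamma0 P a msq * (bondK R j ψ + massK R msq j ψ) ≤ pieceExp R C a (0 : HiggsLattice.VecField P 0) msq j ψ v := by
  have hL' : (1 : ℝ) < P.L := by exact_mod_cast hL
  have hd : (1 : ℝ) ≤ P.d := by exact_mod_cast P.hd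
  -- the pieces
  set T1 := ∑ y : LSite R j, P.mesh (j.val + 1) ^ P.d *
    ‖ψ y - avgQk C (0 : HiggsLattice.VecField P 0) (j.val + 1) (extP R j v) y.val‖ ^ 2 with hT1
  set T2 := ∑ b : HiggsLattice.PBond P 0, if Inside (pieceF R j) b then
    P.mesh 0 ^ P.d * ‖sderiv (extP R j v) b‖ ^ 2 else 0 with hT2
  set T3 := ∑ x : PSite R j, P.mesh 0 ^ P.d * ‖v x‖ ^ 2 with hT3
  set s := P.mesh (j.val + 1) with hs_def
  set ak := B1.aSeq a P.L (j.val + 1) with hak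
  set B : ℝ := 8 * P.d + 2 * msq with hB
  set ainf : ℝ := a * (1 - ((P.L : ℝ) ^ 2)⁻¹) with hainf
  have hs0 : 0 < s := P.mesh_pos _
  have hT1_0 : 0 ≤ T1 := Finset.sum_nonneg fun y _ => mul_nonneg (pow_nonneg hs0.le _) (sq_nonneg _)
  have hT2_0 : 0 ≤ T2 := Finset.sum_nonneg fun b _ => by
    split_ifs
    · exact mul_nonneg (pow_nonneg (P.mesh_pos 0).le _) (sq_nonneg _)
    · exact le_rfl
  have hT3_0 : 0 ≤ T3 := Finset.sum_nonneg fun x _ => mul_nonneg (pow_nonneg (P.mesh_pos 0).le _) (sq_nonneg _)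
  have hB0 : 0 < B := by rw [hB]; linarith
  have hak_gt : ainf < ak := B1.ainf_lt_aSeq ha hL' (j.val + 1) (Nat.le_add_left 1 _)
  have hainf0 : 0 < ainf := by
    have : (1 : ℝ) < (P.L : ℝ) ^ 2 := by nlinarith
    have : ((P.L : ℝ) ^ 2)⁻¹ < 1 := inv_lt_one_of_one_lt₀ this
    exact mul_pos ha (by linarith)
  have hγ0 : 0 < gamma0 P a msq := gamma0_pos ha hL hmsq
  have hγB : gamma0 P a msq * B ≤ ainf := by
    have h := min_le_left (ainf / B) (1 / 4)
    calc gamma0 P a msq * B ≤ ainf / B * B := mul_le_mul_of_nonneg_right h hB0.le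
      _ = ainf := div_mul_cancel₀ _ hB0.ne'
  have hγ4 : gamma0 P a msq ≤ 1 / 4 := min_le_right _ _
  -- the exponent and the two bounds
  have hE : pieceExp R C a (0 : HiggsLattice.VecField P 0) msq j ψ v = ak * s⁻¹ ^ 2 * T1 + T2 + msq * T3 :=
    pieceExp_zero_eq R C a msq j ψ v
  have hb := bondK_le R C hK j ψ v
  have hm := massK_le R C hmsq hK j ψ v
  -- `Y = s⁻²T₁`, `T₁ = s²Y`, `s² ≤ 1`
  set Y := s⁻¹ ^ 2 * T1 with hY
  have hY0 : 0 ≤ Y := mul_nonneg (sq_nonneg _) hT1_0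
  have hT1Y : T1 = s ^ 2 * Y := by rw [hY]; field_simp
  have hs1 : s ^ 2 ≤ 1 := by nlinarith
  have hsum : bondK R j ψ + massK R msq j ψ ≤ B * Y + 4 * T2 + 2 * (msq * T3) := by
    have h2 : 2 * msq * T1 ≤ 2 * msq * Y := by
      rw [hT1Y]
      have : s ^ 2 * Y ≤ Y := by nlinarith
      nlinarith
    rw [hB]
    nlinarith [hb, hm, h2, hY0, hd]
  -- assemble
  calc gamma0 P a msq * (bondK R j ψ + massK R msq j ψ)
      ≤ gamma0 P a msq * (B * Y + 4 * T2 + 2 * (msq * T3)) := mul_le_mul_of_nonneg_left hsum hγ0.le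
    _ = (gamma0 P a msq * B) * Y + (4 * gamma0 P a msq) * T2 + (2 * gamma0 P a msq) * (msq * T3) := by ring
    _ ≤ ak * Y + 1 * T2 + 1 * (msq * T3) := by
        refine add_le_add (add_le_add ?_ ?_) ?_
        · exact mul_le_mul_of_nonneg_right (hγB.trans hak_gt.le) hY0
        · exact mul_le_mul_of_nonneg_right (by linarith) hT2_0
        · exact mul_le_mul_of_nonneg_right (by linarith) (mul_nonneg hmsq hT3_0)
    _ = pieceExp R C a (0 : HiggsLattice.VecField P 0) msq j ψ v := by rw [hE, hY]; ring

/-- **(3.29) AT `Ã^η = 0` ON THE CONCRETE CARRIER, NO ERROR TERM**: for every scale `k = 1, …, K` (`K ≤` the number of scales of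
the lattice family, `Lᵏε ≤ 1`), every region `Λ_k` and EVERY `ψ : Λ_k → ℝ^N`,
`γ₀·(Σ_{⟨y,y′⟩⊂Λ_k}(Lᵏε)^{d−2}|ψ(y′) − ψ(y)|² + Σ_{y∈Λ_k}(Lᵏε)^d m²|ψ(y)|²) ≤ ⟨ψ, Δ^{(k),Lᵏε}(Bᵏ(Λ_k), 0)ψ⟩ = termForm R C a 0 m² j ψ`,
`γ₀ = min(a(1 − L⁻²)/(8d + 2m²), 1/4)`. [cite: Balaban1982Higgs2, (3.29) p.590] -/
theorem ineq329_zero_concrete (ha : 0 < a) (hL : 1 < P.L) (hmsq : 0 ≤ msq) (hK : K ≤ P.K) (j : Fin K)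
    (hs : P.mesh (j.val + 1) ≤ 1) (ψ : LSite R j → V N) :
    gamma0 P a msq * (bondK R j ψ + massK R msq j ψ) ≤ termForm R C a (0 : HiggsLattice.VecField P 0) msq j ψ :=
  le_ciInf fun v => sum329_le_pieceExp R C ha hL hmsq hK j hs ψ v

/-- The same with the form written as `⟨ψ̃, Δ^{(k)}(Bᵏ(Λ_k), 0)ψ̃⟩_{T⁽ᵏ⁾}` for the solved (I.2.21) operator of the tree
(`B1Eq230FluctCov.deltaKA`, via `B2Eq328DeltaK.termForm_eq_deltaKA`; `m² > 0`). [cite: Balaban1982Higgs2, (3.29) p.590]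
[cite: Balaban1982Higgs1, (2.21) p.610] -/
theorem ineq329_zero_deltaKA (ha : 0 < a) (hL : 1 < P.L) (hmsq : 0 < msq) (hK : K ≤ P.K) (j : Fin K)
    (hs : P.mesh (j.val + 1) ≤ 1) (ψ : LSite R j → V N) :
    gamma0 P a msq * (bondK R j ψ + massK R msq j ψ)
      ≤ siteInner (extL R j ψ) (deltaKA C (pieceF R j) (0 : HiggsLattice.VecField P 0) msq a (j.val + 1) (extL R j ψ)) := by
  rw [← termForm_eq_deltaKA R C (0 : HiggsLattice.VecField P 0) ha hL hmsq j ψ]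
  exact ineq329_zero_concrete R C ha hL hmsq.le hK j hs ψ

end Ineq329

/-! ## §3 Proposition 3.1, zero-field clause, on the concrete carrier -/

section Prop31

variable (R : Regions P K) (C : ChargeData N) {a msq : ℝ}

/-- The meshes increase with the scale: `Lʲ⁺¹ε ≤ Lᴷε` for `j + 1 ≤ K` (`L ≥ 1`). [cite: Balaban1982Higgs1, (1.19) p.607] -/
theorem mesh_le_mesh {k k' : ℕ} (hkk : k ≤ k') : P.mesh k ≤ P.mesh k' := by
  unfold HiggsLattice.Params.mesh
  have hL : (1 : ℝ) ≤ P.L := by exact_mod_cast P.hL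
  exact mul_le_mul_of_nonneg_right (pow_le_pow_right₀ hL hkk) P.hε.le

/-- **PROPOSITION 3.1, ZERO-FIELD CLAUSE, ON THE CONCRETE (3.23)/(3.24)/(3.25) CARRIER — HYPOTHESIS-FREE**: for every nested region
data `R` (`K ≤` the number of scales, `Lᴷε ≤ 1`), every `m² > 0`, `a > 0`, `L > 1` and EVERY configuration `Φ` of (3.24),
`γ₀(Σ_{k=0}^{K} bond_k) + γ₀(Σ_{k=0}^{K} mass_k) ≤ ⟨Φ, Δ(0)Φ⟩ = form325 R C a 0 m² Φ` — *"the inequality holds without the last sum on the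
right side and without any restrictions on the configuration Φ"* — with `γ₀ = min(a(1 − L⁻²)/(8d + 2m²), 1/4)`: the printed reduction
`B2Eq328ConcretePieces.prop31_concrete` ((3.27) + (3.28) + the `k = 0` term) with its per-scale input (3.29)₀ DISCHARGED by
`ineq329_zero_concrete`. [cite: Balaban1982Higgs2, Prop. 3.1 (3.26) p.589] -/
theorem prop31_zeroField_concrete (hR : Nested R) (hK : K ≤ P.K) (hε : P.mesh K ≤ 1) (ha : 0 < a) (hL : 1 < P.L)
    (hmsq : 0 < msq) (Φ : Cfg R N) :
    gamma0 P a msq * (bond0 R C (0 : HiggsLattice.VecField P 0) Φ.1 + ∑ j, bondK R j (resL R j Φ))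
        + gamma0 P a msq * (mass0 R msq Φ.1 + ∑ j, massK R msq j (resL R j Φ))
      ≤ form325 R C a (0 : HiggsLattice.VecField P 0) msq Φ := by
  have hγ1 : gamma0 P a msq ≤ 1 := (min_le_right _ _).trans (by norm_num)
  have h := prop31_concrete R C (0 : HiggsLattice.VecField P 0) hR ha hL hmsq hγ1 (fun j ψ => bondK R j ψ)
    (fun j ψ => massK R msq j ψ) (fun _ => 0) (fun j ψ => by
      rw [sub_zero]
      exact ineq329_zero_concrete R C ha hL hmsq.le hK j
        ((mesh_le_mesh (Nat.succ_le_of_lt j.isLt)).trans hε) ψ) Φ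
  simpa using h

/-- **The same for the printed regions** `Λ_k = Λ₅⁽ᵏ⁻¹⁾′ ∩ Λ₅⁽ᵏ⁾ᶜ` built from a tower of large-field regions
(`B2Eq324NestedRegions.Tower`, whose `nested_regions` discharges `Nested`). [cite: Balaban1982Higgs2, Prop. 3.1 (3.26) p.589] -/
theorem prop31_zeroField_tower (T : Tower P K) (C : ChargeData N) (hK : K ≤ P.K) (hε : P.mesh K ≤ 1) (ha : 0 < a)
    (hL : 1 < P.L) (hmsq : 0 < msq) (Φ : Cfg T.regions N) :
    gamma0 P a msq * (bond0 T.regions C (0 : HiggsLattice.VecField P 0) Φ.1 + ∑ j, bondK T.regions j (resL T.regions j Φ))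
        + gamma0 P a msq * (mass0 T.regions msq Φ.1 + ∑ j, massK T.regions msq j (resL T.regions j Φ))
      ≤ form325 T.regions C a (0 : HiggsLattice.VecField P 0) msq Φ :=
  prop31_zeroField_concrete T.regions C T.nested_regions hK hε ha hL hmsq Φ

end Prop31

end Literature.MathematicalPhysics.QuantumFieldTheory.Balaban1983to89.B2Prop31ZeroFieldConcrete
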